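import Summits.ValiantsHypothesis.ValiantsHypothesis.Theorems.KPlusLogSqLawTropicalBScaleSeparation

/-!
# Route `KPlusLogSqLaw`, crux `TropicalB` — SCALE SEPARATION, part 2: the lex law by exponent values; the strict step

HONEST FRAMING.  Support file toward the registered stubs `stub_tropThin` / `stub_tropFat` of the crux `TropicalB`
(ledger item `stmt-ValiantsHypothesis-19771`, route `KPlusLogSqLaw`; cell `pub-symmetroid`, seat val-sym-trop-p4, 2026-08-26).
Continuation of `…TropicalBScaleSeparation` (split off for the 400-line rule); structural lemmas only, nothing asserted about
`TropicalB` inside its window, `Lifting`, `KPlusLogSqLaw`, `MatrixDescartes` or `VP ≠ VNP`.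

* `sum_above_eq_of_countVal` — the part of the total exponent above a threshold depends only on the VALUE counts
  (`#{i : d (r i) = D}`, `D > D₀`); no injectivity of `d` is needed (repeated exponents are fine).
* `countVal_le_of_dominant_lexVal` — THE LEX LEMMA with the value-count hypothesis (the form of part 1 asked for equal
  CLASS counts above the threshold).
* `sum_d_eq_of_countVal_eq` — equal value counts at every value ⇒ equal total exponent.
* `exists_lex_strict_step` — **STRICT LEX STEP**: under super-increasing exponent values (`d l < d l' ⇒ m·d l < d l'`),
  between the unique optimum `p` at `θa` and the unique optimum `q ≠ p` at `θb > θa` there is a value `d t` whose column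
  count strictly increases while every larger value's count is unchanged.  So along every dominant sign-alternating chain the
  exponent profile is STRICTLY INCREASING in the lexicographic order read from the top value: the chain is an odometer on the
  value counts (which re-proves slope counting in this regime, and is the form every «carry-cost» analysis starts from).

[folklore] (exchange/convexity argument).
-/

-- `Summit.ValiantsHypothesis.ValiantsHypothesis.…` repeats a component by the D-0017 layout
-- (single-conjunct summit), which the `dupNamespace` linter flags; the name is mandated.
set_option linter.dupNamespace false
set_option autoImplicit false

namespace Summit.ValiantsHypothesis.ValiantsHypothesis.Theorems.LacunarySymmetroidMatrixDescartes.TropicalCensus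

open Summit.ValiantsHypothesis.ValiantsHypothesis.Theorems.MatrixDescartes.Negative
open Finset

section LexStrict

variable {m K : ℕ}

/-! ## The lex law by exponent VALUES and the strict step -/

/-- the part of the slope above `D₀` only depends on the numbers of columns of each exponent VALUE `> D₀`
(value form of `sum_above_eq_of_countClass`; no injectivity of `d` needed). [folklore] -/
theorem sum_above_eq_of_countVal (d : Fin K → ℕ) (r r' : Fin m → Fin K) (D₀ : ℕ)
    (hagree : ∀ D : ℕ, D₀ < D →
      (univ.filter fun i => d (r i) = D).card = (univ.filter fun i => d (r' i) = D).card) :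
    ∑ i ∈ univ.filter (fun i => D₀ < d (r i)), d (r i) = ∑ i ∈ univ.filter (fun i => D₀ < d (r' i)), d (r' i) := by
  -- common index set of values
  set T : Finset ℕ := univ.image (fun i => d (r i)) ∪ univ.image (fun i => d (r' i)) with hT
  have key : ∀ s : Fin m → Fin K, (∀ i, d (s i) ∈ T) →
      ∑ i ∈ univ.filter (fun i => D₀ < d (s i)), d (s i) =
        ∑ D ∈ T, (if D₀ < D then D * (univ.filter fun i => d (s i) = D).card else 0) := by
    intro s hs
    rw [← sum_fiberwise_of_maps_to (s := univ.filter fun i => D₀ < d (s i)) (t := T) (g := fun i => d (s i))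
      (fun i _ => hs i) (fun i => d (s i))]
    refine sum_congr rfl fun D _ => ?_
    split_ifs with h
    · rw [filter_filter, sum_congr rfl (fun i hi => ((mem_filter.mp hi).2.2 : d (s i) = D)), sum_const, smul_eq_mul,
        mul_comm]
      congr 2
      ext i
      simp only [mem_filter, mem_univ, true_and]
      constructor
      · exact fun hh => hh.2
      · intro hh; exact ⟨hh ▸ h, hh⟩
    · apply sum_eq_zero
      intro i hi
      rw [mem_filter, mem_filter] at hi
      exact absurd (hi.2 ▸ hi.1.2) h
  have hr : ∀ i, d (r i) ∈ T := fun i => mem_union_left _ (mem_image_of_mem _ (mem_univ i))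
  have hr' : ∀ i, d (r' i) ∈ T := fun i => mem_union_right _ (mem_image_of_mem _ (mem_univ i))
  rw [key r hr, key r' hr']
  refine sum_congr rfl fun D _ => ?_
  split_ifs with h
  · rw [hagree D h]
  · rfl

/-- **THE LEX LEMMA, value form.**  As `countVal_le_of_dominant_lex`, with the hypothesis on the numbers of columns of each
exponent VALUE above `D₀ = d t` (so repeated exponents need no special treatment): under super-increasing values, if `p`
(optimum at `θa`) and `q ≠ p` (optimum at `θb > θa`) have equally many columns of every exponent value `> d t`, then the number
of columns of exponent `d t` does not drop. [folklore] -/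
theorem countVal_le_of_dominant_lexVal (d : Fin K → ℕ) (hsup : ∀ l l' : Fin K, d l < d l' → m * d l < d l')
    (v ε : Fin m → Fin m → Fin K → ℤ) {θa θb : ℤ} (hab : θa < θb) {p q : Equiv.Perm (Fin m) × (Fin m → Fin K)}
    (hne : p ≠ q) (ha : IsDominant d v ε θa p) (hb : IsDominant d v ε θb q) (t : Fin K)
    (hagree : ∀ D : ℕ, d t < D →
      (univ.filter fun i => d (p.2 i) = D).card = (univ.filter fun i => d (q.2 i) = D).card) :
    (univ.filter fun i => d (p.2 i) = d t).card ≤ (univ.filter fun i => d (q.2 i) = d t).card := by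
  set D₀ := d t with hD₀
  by_contra hcon
  push Not at hcon
  have hslope := sum_d_lt_of_dominant d v ε hab hne ha hb
  rw [sum_d_split3 d p.2 D₀, sum_d_split3 d q.2 D₀, sum_above_eq_of_countVal d p.2 q.2 D₀ hagree] at hslope
  set cp := (univ.filter fun i => d (p.2 i) = D₀).card
  set cq := (univ.filter fun i => d (q.2 i) = D₀).card
  set Bp := ∑ i ∈ univ.filter (fun i => d (p.2 i) < D₀), d (p.2 i)
  set Bq := ∑ i ∈ univ.filter (fun i => d (q.2 i) < D₀), d (q.2 i)
  set nb := (univ.filter fun i => d (q.2 i) < D₀).card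
  have h1 : D₀ * cp + Bp < D₀ * cq + Bq := by omega
  have hbelow : m * Bq + nb ≤ nb * D₀ := sum_below_bound d hsup q.2 t
  have hnb : nb ≤ m := by
    have := card_le_univ (univ.filter fun i => d (q.2 i) < D₀)
    rwa [Fintype.card_fin] at this
  rcases Nat.eq_zero_or_pos m with hm | hm
  · subst hm
    have h0 : cp = 0 := by simp [cp]
    omega
  rcases Nat.eq_zero_or_pos nb with hnb0 | hnb0
  · have hBq : Bq = 0 := by
      have : (univ.filter fun i => d (q.2 i) < D₀) = ∅ := card_eq_zero.mp hnb0
      simp only [Bq, this, sum_empty]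
    have : D₀ * cp < D₀ * cq := by omega
    have := Nat.lt_of_mul_lt_mul_left this
    omega
  · have h2 : m * Bq < m * D₀ := by
      have := Nat.mul_le_mul_right D₀ hnb
      omega
    have h3 : m * (D₀ * cp) < m * (D₀ * cq) + m * D₀ := by
      have := Nat.mul_lt_mul_of_pos_left h1 hm
      rw [Nat.mul_add, Nat.mul_add] at this
      omega
    have h4 : m * (D₀ * cq) + m * D₀ ≤ m * (D₀ * cp) := by
      rw [← Nat.mul_add, ← Nat.mul_succ]
      exact Nat.mul_le_mul_left _ (Nat.mul_le_mul_left _ hcon)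
    omega

/-- the total exponent is the value-weighted sum of the value counts: if two class maps have equally many columns of
every exponent value `d t`, their total exponents agree. [folklore] -/
theorem sum_d_eq_of_countVal_eq (d : Fin K → ℕ) (r r' : Fin m → Fin K)
    (h : ∀ t : Fin K, (univ.filter fun i => d (r i) = d t).card = (univ.filter fun i => d (r' i) = d t).card) :
    ∑ i, d (r i) = ∑ i, d (r' i) := by
  have hall : ∀ D : ℕ, (univ.filter fun i => d (r i) = D).card = (univ.filter fun i => d (r' i) = D).card := by
    intro D
    by_cases hD : ∃ t, d t = D
    · obtain ⟨t, rfl⟩ := hD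
      exact h t
    · push Not at hD
      have e1 : (univ.filter fun i => d (r i) = D) = ∅ :=
        filter_eq_empty_iff.mpr fun i _ hh => hD (r i) hh
      have e2 : (univ.filter fun i => d (r' i) = D) = ∅ :=
        filter_eq_empty_iff.mpr fun i _ hh => hD (r' i) hh
      rw [e1, e2]
  have key : ∀ s : Fin m → Fin K, ∑ i, d (s i) = ∑ i ∈ univ.filter (fun i => 0 < d (s i)), d (s i) := by
    intro s
    rw [← sum_filter_add_sum_filter_not univ (fun i => 0 < d (s i))]
    have : ∑ i ∈ univ.filter (fun i => ¬ 0 < d (s i)), d (s i) = 0 :=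
      sum_eq_zero fun i hi => by have := (mem_filter.mp hi).2; omega
    rw [this, add_zero]
  rw [key r, key r', sum_above_eq_of_countVal d r r' 0 (fun D _ => hall D)]

/-- **STRICT LEX STEP.**  Under super-increasing exponent values, between the unique optimum `p` at `θa` and the unique
optimum `q ≠ p` at `θb > θa` there is an exponent value `d t` at which the number of columns STRICTLY INCREASES while it is
unchanged at every larger value: the exponent profile moves strictly up in the lexicographic order (values read from the
top).  Proof: the profiles differ somewhere (else the total exponents agree, against the slope law); take `t` of maximal
exponent among the classes whose value count differs, and apply `countVal_le_of_dominant_lexVal`. [folklore] -/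
theorem exists_lex_strict_step (d : Fin K → ℕ) (hsup : ∀ l l' : Fin K, d l < d l' → m * d l < d l')
    (v ε : Fin m → Fin m → Fin K → ℤ) {θa θb : ℤ} (hab : θa < θb) {p q : Equiv.Perm (Fin m) × (Fin m → Fin K)}
    (hne : p ≠ q) (ha : IsDominant d v ε θa p) (hb : IsDominant d v ε θb q) :
    ∃ t : Fin K, (∀ D : ℕ, d t < D →
        (univ.filter fun i => d (p.2 i) = D).card = (univ.filter fun i => d (q.2 i) = D).card) ∧
      (univ.filter fun i => d (p.2 i) = d t).card < (univ.filter fun i => d (q.2 i) = d t).card := by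
  -- the classes whose value count differs
  set S : Finset (Fin K) := univ.filter fun t =>
    (univ.filter fun i => d (p.2 i) = d t).card ≠ (univ.filter fun i => d (q.2 i) = d t).card with hS
  have hSne : S.Nonempty := by
    by_contra h0
    rw [not_nonempty_iff_eq_empty] at h0
    have hall : ∀ t : Fin K,
        (univ.filter fun i => d (p.2 i) = d t).card = (univ.filter fun i => d (q.2 i) = d t).card := by
      intro t
      by_contra hh
      have : t ∈ S := mem_filter.mpr ⟨mem_univ _, hh⟩
      rw [h0] at this
      exact absurd this (notMem_empty t)
    have heq := sum_d_eq_of_countVal_eq d p.2 q.2 hall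
    have hlt := sum_d_lt_of_dominant d v ε hab hne ha hb
    omega
  obtain ⟨t, htS, htmax⟩ := exists_max_image S d hSne
  have hagree : ∀ D : ℕ, d t < D →
      (univ.filter fun i => d (p.2 i) = D).card = (univ.filter fun i => d (q.2 i) = D).card := by
    intro D hD
    by_cases hex : ∃ l, d l = D
    · obtain ⟨l, rfl⟩ := hex
      by_contra hh
      have hl : l ∈ S := mem_filter.mpr ⟨mem_univ _, hh⟩
      exact absurd (htmax l hl) (not_le.mpr hD)
    · push Not at hex
      have e1 : (univ.filter fun i => d (p.2 i) = D) = ∅ :=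
        filter_eq_empty_iff.mpr fun i _ hh => hex (p.2 i) hh
      have e2 : (univ.filter fun i => d (q.2 i) = D) = ∅ :=
        filter_eq_empty_iff.mpr fun i _ hh => hex (q.2 i) hh
      rw [e1, e2]
  refine ⟨t, hagree, lt_of_le_of_ne (countVal_le_of_dominant_lexVal d hsup v ε hab hne ha hb t hagree) ?_⟩
  exact (mem_filter.mp htS).2

end LexStrict

end Summit.ValiantsHypothesis.ValiantsHypothesis.Theorems.LacunarySymmetroidMatrixDescartes.TropicalCensus
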